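import Literature.Probability.LatticeModels.KilledWalkHubFactorisation
import HarnessLib

/-!
# Exact strong Markov for the hub and the "good separator" upper bound

Sub-problem `CriticalPhenomena/SAWScalingLimit`, crux `AvoidanceLimit`, line `symplectic-fermion-anchor`
(lead c7), stub `stub_germTwoSided` (Chelkak 2016 Prop. 3.1/3.3 for the edge-killed walk). Two glue lemmas of
the separator decomposition `killedPoisson_le_separator` (`KilledWalkHubFactorisation.lean`):

* `sum_killedPoisson_mul_hitProb_le` — the EXACT strong Markov inequality
  `∑_{w ∈ W} P_{Λ∖(B∪W)}(m,w) · hitProb_B(w) ≤ hitProb_B(m)` (to hit `B` it suffices to enter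
  `B ∪ W` through `w` and then hit `B`); `sum_wall_le` is its `θ`-thresholded form.
* `killedPoisson_le_of_goodSeparator` — if every wall site is GOOD, `P_Λ(w,x) ≤ C·M·hitProb_B(w)`
  (`M ≥ sup_B P_Λ(·,x)`), and `B ∪ W` separates `m ∈ Λ` from `x` (`P_{Λ∖(B∪W)}(m,x) = 0`), then
  `P_Λ(m,x) ≤ (1 + C)·M·hitProb_B(m)`: the factorisation upper bound holds at `m`.

[cite: Chelkak2016, Proposition 3.3 and §3.2]
-/

noncomputable section

open scoped Classical BigOperators

namespace Summit.CriticalPhenomena.SAWScalingLimit.Theorems.AvoidanceLimit.Anchor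

open Finset Literature.Probability.LatticeModels

variable {Gr : SimpleGraph (Site 2)}

/-- **Exact strong Markov inequality for the hub.** For the edge-killed walk `Gr` in the finite
region `Λ`, hub `B` and wall `W` (`Wf` its finset): the probability of entering `B ∪ W` first at a
wall site `w` and then hitting `B`, summed over `w`, is at most the probability of hitting `B`.
[cite: Chelkak2016, §3.2] -/
theorem sum_killedPoisson_mul_hitProb_le :
    ∀ (Gr : SimpleGraph (Site 2)) (Λ B W : Set (Site 2)), Λ.Finite →
      ∀ (Wf : Finset (Site 2)), (∀ w, w ∈ Wf ↔ w ∈ W) → ∀ m : Site 2,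
        ∑ w ∈ Wf, killedPoisson Gr (Λ \ (B ∪ W)) m w * hitProb Gr Λ B w ≤ hitProb Gr Λ B m := by
  intro Gr Λ B W hΛ Wf hWf m
  set S := Λ \ (B ∪ W) with hS
  have hSfin : S.Finite := hΛ.subset fun _ hz => hz.1
  by_cases hm : m ∈ S
  · -- on the region: the sum is the killed-harmonic extension of `𝟙_W · hitProb_B` to `S`
    have hrep : ∑ w ∈ Wf, killedPoisson Gr S m w * hitProb Gr Λ B w =
        killedHarmExt Gr S (fun w => if w ∈ W then hitProb Gr Λ B w else 0) m := by
      rw [killedHarmExt_eq_sum_killedPoisson hSfin _ m hm]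
      set E := (killedOuterBoundary_finite (Gr := Gr) hSfin).toFinset with hE
      have hmemE : ∀ w, w ∈ E ↔ w ∈ killedOuterBoundary Gr S := fun w => Set.Finite.mem_toFinset _
      -- exits of `S` outside `W` contribute `0`
      rw [show ∑ w ∈ E, killedPoisson Gr S m w * (if w ∈ W then hitProb Gr Λ B w else 0) =
          ∑ w ∈ E.filter (fun w => w ∈ Wf), killedPoisson Gr S m w * hitProb Gr Λ B w from by
        rw [Finset.sum_filter]
        refine Finset.sum_congr rfl fun w _ => ?_
        by_cases hw : w ∈ W
        · rw [if_pos hw, if_pos ((hWf w).2 hw)]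
        · rw [if_neg hw, if_neg (fun h => hw ((hWf w).1 h)), mul_zero]]
      -- wall sites off the exit set of `S` contribute `0` (Poisson kernel with pole off the boundary)
      refine (Finset.sum_subset (fun w hw => (Finset.mem_filter.1 hw).2) ?_).symm
      intro w hw hw'
      have hwE : w ∉ killedOuterBoundary Gr S := fun h => hw' (Finset.mem_filter.2 ⟨(hmemE w).2 h, hw⟩)
      rw [killedPoisson_eq_zero_of_not_mem_boundary hSfin hwE m hm, zero_mul]
    rw [hrep]
    -- compare the two killed-harmonic functions on `S ⊆ Λ ∖ B` through their boundary values
    have h1 : IsKilledHarmonicOn Gr (killedHarmExt Gr S fun w => if w ∈ W then hitProb Gr Λ B w else 0) S :=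
      killedHarmExt_harmonicOn hSfin _
    have h2 : IsKilledHarmonicOn Gr (hitProb Gr Λ B) S :=
      (hitProb_harmonicOn hΛ).mono fun z hz => ⟨hz.1, fun h => hz.2 (Or.inl h)⟩
    refine le_of_killedSub_killedSuper_of_boundary hSfin h1.subharmonicOn h2.superharmonicOn ?_ m hm
    intro z hz
    rw [killedHarmExt_of_not_mem _ hz.1]
    by_cases hzW : z ∈ W
    · rw [if_pos hzW]
    · rw [if_neg hzW]; exact hitProb_nonneg hΛ z
  · -- off the region: `P_S(m,·) = 𝟙[m = ·]`, the sum is `𝟙[m ∈ Wf] · hitProb_B(m)`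
    have hpt : ∀ w ∈ Wf, killedPoisson Gr S m w * hitProb Gr Λ B w =
        if m = w then hitProb Gr Λ B w else 0 := by
      intro w _
      rw [killedPoisson_of_not_mem hm]
      split_ifs
      · rw [one_mul]
      · rw [zero_mul]
    rw [Finset.sum_congr rfl hpt, Finset.sum_ite_eq]
    split_ifs
    · exact le_rfl
    · exact hitProb_nonneg hΛ m

/-- **Good separator ⇒ factorisation upper bound.** If `M` bounds `P_Λ(·,x)` on the hub `B ⊆ Λ`,
every wall site `w ∈ W` is good (`P_Λ(w,x) ≤ C·M·hitProb_B(w)`), and `B ∪ W` separates `m ∈ Λ`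
from the exit `x ∉ Λ` (`P_{Λ∖(B∪W)}(m,x) = 0`), then `P_Λ(m,x) ≤ (1 + C)·M·hitProb_B(m)`.
[cite: Chelkak2016, Proposition 3.3] -/
theorem killedPoisson_le_of_goodSeparator :
    ∀ (Gr : SimpleGraph (Site 2)) (Λ B W : Set (Site 2)), Λ.Finite → B ⊆ Λ →
      ∀ (Wf : Finset (Site 2)), (∀ w, w ∈ Wf ↔ w ∈ W) →
      ∀ (x : Site 2), x ∉ Λ → ∀ (M C : ℝ), 0 ≤ M → 0 ≤ C →
        (∀ w ∈ B, killedPoisson Gr Λ w x ≤ M) →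
        (∀ w ∈ W, killedPoisson Gr Λ w x ≤ C * M * hitProb Gr Λ B w) →
        ∀ m ∈ Λ, killedPoisson Gr (Λ \ (B ∪ W)) m x = 0 →
          killedPoisson Gr Λ m x ≤ (1 + C) * M * hitProb Gr Λ B m := by
  intro Gr Λ B W hΛ hBΛ Wf hWf x hx M C hM0 hC0 hM hgood m hmΛ hsep0
  have hh0 : 0 ≤ hitProb Gr Λ B m := hitProb_nonneg hΛ m
  by_cases hmB : m ∈ B
  · -- on the hub: `P_Λ(m,x) ≤ M = M · hitProb_B(m)`
    rw [hitProb_of_mem hmB, mul_one]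
    have hPm := hM m hmB
    nlinarith
  by_cases hmW : m ∈ W
  · -- on the wall: `m` itself is good
    have hPm := hgood m hmW
    nlinarith
  -- inside `S = Λ ∖ (B ∪ W)`: separator decomposition, good wall sites, exact strong Markov
  have hmS : m ∈ Λ \ (B ∪ W) := ⟨hmΛ, fun h => h.elim hmB hmW⟩
  have hSfin : (Λ \ (B ∪ W)).Finite := hΛ.subset fun _ hz => hz.1
  have hsep := killedPoisson_le_separator hΛ hBΛ hx hM0 hM Wf hWf hmS
  rw [hsep0, zero_add] at hsep
  have hwall : ∑ w ∈ Wf, killedPoisson Gr (Λ \ (B ∪ W)) m w * killedPoisson Gr Λ w x ≤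
      C * M * hitProb Gr Λ B m :=
    calc ∑ w ∈ Wf, killedPoisson Gr (Λ \ (B ∪ W)) m w * killedPoisson Gr Λ w x
        ≤ ∑ w ∈ Wf, killedPoisson Gr (Λ \ (B ∪ W)) m w * (C * M * hitProb Gr Λ B w) :=
          Finset.sum_le_sum fun w hw =>
            mul_le_mul_of_nonneg_left (hgood w ((hWf w).1 hw)) (killedPoisson_nonneg hSfin m w)
      _ = C * M * ∑ w ∈ Wf, killedPoisson Gr (Λ \ (B ∪ W)) m w * hitProb Gr Λ B w := by
          rw [Finset.mul_sum]
          refine Finset.sum_congr rfl fun w _ => ?_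
          ring
      _ ≤ C * M * hitProb Gr Λ B m :=
          mul_le_mul_of_nonneg_left (sum_killedPoisson_mul_hitProb_le Gr Λ B W hΛ Wf hWf m)
            (mul_nonneg hC0 hM0)
  calc killedPoisson Gr Λ m x
      ≤ M * hitProb Gr Λ B m + ∑ w ∈ Wf, killedPoisson Gr (Λ \ (B ∪ W)) m w * killedPoisson Gr Λ w x := hsep
    _ ≤ M * hitProb Gr Λ B m + C * M * hitProb Gr Λ B m := by linarith
    _ = (1 + C) * M * hitProb Gr Λ B m := by ring

end Summit.CriticalPhenomena.SAWScalingLimit.Theorems.AvoidanceLimit.Anchor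

end
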